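import Literature.MathematicalPhysics.QuantumFieldTheory.ConformalBootstrap3D.BlockZSeriesABOfLt
import Literature.MathematicalPhysics.QuantumFieldTheory.ConformalBootstrap3D.HRCoeffABGeometricMean
import HarnessLib

/-!
# The `(n,j)` double series of a mixed-channel block for GENERAL `(Δ₁₂, Δ₃₄)`

`BlockZSeriesAB` / `BlockZSeriesABOfLt` give the Dolan–Osborn `z`-series of a genuine block
`g^{Δ₁₂,Δ₃₄}_{Δ,ℓ}` as a convergent LEVEL series for every `(Δ₁₂, Δ₃₄)`
(`IsConformalBlock3D.hasSum_hrLevelAB_of_lt`), but as a genuine `(n,j)`-indexed double series only for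
the reflection-positive orderings `Δ₁₂ = −Δ₃₄` (non-negative terms) and for the family `Δ₁₂ = Δ₃₄`
(absolutely, by the geometric-mean identity `A(a,−a)² = A(a,a)A(−a,−a)`).  With the general identity
`A_{n,j}(a,b)² = A_{n,j}(a,a) A_{n,j}(b,b)` (`HRCoeffABGeometricMean`) the same domination argument
works for EVERY ordering:

* `hrZTermAB_sq_eq_self_mul_self` — termwise `T_q(a,b)² = T_q(a,a) T_q(b,b)`;
* `IsConformalBlock3D.hasSum_hrZTermAB_general_of_lt` — for `g` with `IsConformalBlock3D Δ₁₂ Δ₃₄ Δ ℓ g`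
  at ANY `Δ` strictly above the unitarity bound (`Δ ≠ 1` if `ℓ = 0`; accidental degeneracies included),
  `Σ_{(n,j)} (A_{n,j}(−Δ₁₂/2, Δ₃₄/2)/λ_ℓ) 𝒫_{Δ+n,j}(x,y) = g(x,y)` on the open square, ABSOLUTELY;
* `hasSum_pointFunctional_crossF_hrZAB_general` — the termwise action of a point functional:
  `φ[F^{s}_{σ}[g]] = Σ_{(n,j)} (A_{n,j}(a,b)/λ_ℓ) φ[F^{s}_{σ}[𝒫_{Δ+n,j}]]`, and the head–tail rule
  `pointFunctional_crossF_nonneg_of_termwise_general` for a block whose coefficients have a KNOWN SIGN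
  pattern on the tail (e.g. via `hrCoeffAB_nonneg_of_doPochFactor_nonneg`).

USE (planning note, O(2) three-scalar scan): the off-diagonal blocks of the `2 × 2` sectors `1`, `2⁺`
(`F^{φφ,st}`, `F^{φs,φt}`, `F^{sφ,φt}`) have `|Δ₁₂| ≠ |Δ₃₄|`.  Pure analysis on the tree's definitions; no
numerics, no new definitions.

References: Dolan–Osborn, Nucl. Phys. B 678 (2004) 491, §3 eqs. (3.9)–(3.12) (`DolanOsborn2004`);
Kos–Poland–Simmons-Duffin, JHEP 11 (2014) 109, §3.3 eq. (3.16), §4 (`KosPolandSimmonsduffin2014`).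
-/

namespace Literature.MathematicalPhysics.QuantumFieldTheory.ConformalBootstrap3D

open Finset Set Filter Topology

/-- **Termwise geometric mean, general ordering**: `T_q(a,b)² = T_q(a,a) · T_q(b,b)` strictly above the
unitarity bound (`Δ ≠ 1` if `ℓ = 0`). [cite: DolanOsborn2004, §3 eq. (3.11)] -/
theorem hrZTermAB_sq_eq_self_mul_self {Δ : ℝ} {ℓ : ℕ} (hΔ : unitarityBound3D ℓ < Δ)
    (h1 : ℓ = 0 → Δ ≠ 1) (a b x y : ℝ) (q : ℕ × ℕ) :
    hrZTermAB a b Δ ℓ x y q ^ 2 = hrZTermAB a a Δ ℓ x y q * hrZTermAB b b Δ ℓ x y q := by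
  unfold hrZTermAB
  have hP := (doPochFactor_zero_zero_pos hΔ h1 q.1 q.2).ne'
  have key := hrCoeffAB_sq_eq_self_mul_self (a := a) (b := b) (ℓ := ℓ) (n := q.1) (j := q.2) hP
  rw [mul_pow, div_pow, key]
  ring

/-- The non-negative majorant series `Σ T_q(a,a) = hrBlockAB(−2a, 2a)` at every `Δ` strictly above the
bound. [cite: DolanOsborn2004, §3 eqs. (3.9)–(3.12)] -/
theorem hasSum_hrZTermAB_self_hrBlockAB (a : ℝ) {Δ : ℝ} {ℓ : ℕ} (hΔ : unitarityBound3D ℓ < Δ)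
    {x y : ℝ} (hx : x ∈ Ioo (0 : ℝ) 1) (hy : y ∈ Ioo (0 : ℝ) 1) :
    HasSum (hrZTermAB a a Δ ℓ x y) (hrBlockAB (-(2 * a)) (2 * a) Δ ℓ x y) := by
  have h := hasSum_hrZTermAB_hrBlockAB (Δ₁₂ := -(2 * a)) (Δ₃₄ := 2 * a) (ℓ := ℓ) hΔ (by ring) hx hy
  have e : 2 * a / 2 = a := by ring
  rw [e] at h
  exact h

/-- **The `(n,j)` series of a genuine block with ARBITRARY `(Δ₁₂, Δ₃₄)` at every `Δ` strictly above the
bound** (`Δ ≠ 1` if `ℓ = 0`): `Σ_{(n,j)} (A_{n,j}(−Δ₁₂/2, Δ₃₄/2)/λ_ℓ) 𝒫_{Δ+n,j}(x,y) = g(x,y)`,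
absolutely (domination by the two reflection-positive series through the geometric-mean identity).
[cite: DolanOsborn2004, §3 eqs. (3.9)–(3.12)] [cite: KosPolandSimmonsduffin2014, §4 eqs. (4.2)–(4.3)] -/
theorem IsConformalBlock3D.hasSum_hrZTermAB_general_of_lt {Δ₁₂ Δ₃₄ Δ : ℝ} {ℓ : ℕ} {g : ℝ → ℝ → ℝ}
    (hΔ : unitarityBound3D ℓ < Δ) (h1 : ℓ = 0 → Δ ≠ 1) (h : IsConformalBlock3D Δ₁₂ Δ₃₄ Δ ℓ g)
    {x y : ℝ} (hx : x ∈ Ioo (0 : ℝ) 1) (hy : y ∈ Ioo (0 : ℝ) 1) :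
    HasSum (hrZTermAB (-Δ₁₂ / 2) (Δ₃₄ / 2) Δ ℓ x y) (g x y) ∧
      Summable (fun q => |hrZTermAB (-Δ₁₂ / 2) (Δ₃₄ / 2) Δ ℓ x y q|) := by
  have hP := hasSum_hrZTermAB_self_hrBlockAB (-Δ₁₂ / 2) (ℓ := ℓ) hΔ hx hy
  have hQ := hasSum_hrZTermAB_self_hrBlockAB (Δ₃₄ / 2) (ℓ := ℓ) hΔ hx hy
  have hsq := fun q => hrZTermAB_sq_eq_self_mul_self hΔ h1 (-Δ₁₂ / 2) (Δ₃₄ / 2) x y q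
  have hPnn := fun q => hrZTermAB_self_nonneg (-Δ₁₂ / 2) hΔ hx.1.le hy.1.le q
  have hQnn := fun q => hrZTermAB_self_nonneg (Δ₃₄ / 2) hΔ hx.1.le hy.1.le q
  have habs : Summable (fun q => |hrZTermAB (-Δ₁₂ / 2) (Δ₃₄ / 2) Δ ℓ x y q|) :=
    summable_abs_of_sq_eq_mul hsq hPnn hQnn hP hQ
  refine ⟨?_, habs⟩
  have hT : HasSum (hrZTermAB (-Δ₁₂ / 2) (Δ₃₄ / 2) Δ ℓ x y)
      (∑' q, hrZTermAB (-Δ₁₂ / 2) (Δ₃₄ / 2) Δ ℓ x y q) :=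
    (habs.of_norm_bounded (fun q => by rw [Real.norm_eq_abs])).hasSum
  have hfib : ∀ n : ℕ, HasSum (fun j : ℕ => hrZTermAB (-Δ₁₂ / 2) (Δ₃₄ / 2) Δ ℓ x y (n, j))
      (hrLevelAB (-Δ₁₂ / 2) (Δ₃₄ / 2) Δ ℓ x y n) := by
    intro n
    unfold hrLevelAB
    refine hasSum_sum_of_ne_finset_zero fun j hj => ?_
    rw [Finset.mem_range, not_lt] at hj
    unfold hrZTermAB
    simp only
    rw [hrCoeffAB_eq_zero_of_lt _ _ Δ (show ℓ + n < j by omega), zero_div, zero_mul]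
  have hlev : HasSum (hrLevelAB (-Δ₁₂ / 2) (Δ₃₄ / 2) Δ ℓ x y)
      (∑' q, hrZTermAB (-Δ₁₂ / 2) (Δ₃₄ / 2) Δ ℓ x y q) := hT.prod_fiberwise hfib
  have hlev' : HasSum (hrLevelAB (-Δ₁₂ / 2) (Δ₃₄ / 2) Δ ℓ x y) (g x y) := h.hasSum_hrLevelAB_of_lt hΔ hx hy
  rwa [hlev.unique hlev'] at hT

/-- **Termwise action of a point functional on a block with ARBITRARY `(Δ₁₂, Δ₃₄)`**, every `Δ` strictly
above the bound (`Δ ≠ 1` if `ℓ = 0`):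
`φ[F^{s}_{σ}[g]] = Σ_{(n,j)} (A_{n,j}(−Δ₁₂/2, Δ₃₄/2)/λ_ℓ) φ[F^{s}_{σ}[𝒫_{Δ+n,j}]]`.
[cite: DolanOsborn2004, §3 eqs. (3.10)–(3.12)] [cite: KosPolandSimmonsduffin2014, §3.3 eq. (3.16)] -/
theorem hasSum_pointFunctional_crossF_hrZAB_general {n : ℕ} (w z zb : Fin n → ℝ)
    (hz : ∀ k, z k ∈ Ioo (0 : ℝ) 1) (hzb : ∀ k, zb k ∈ Ioo (0 : ℝ) 1) (s sign : ℝ)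
    {Δ₁₂ Δ₃₄ Δ : ℝ} {ℓ : ℕ} {g : ℝ → ℝ → ℝ} (hΔ : unitarityBound3D ℓ < Δ) (h1 : ℓ = 0 → Δ ≠ 1)
    (h : IsConformalBlock3D Δ₁₂ Δ₃₄ Δ ℓ g) :
    HasSum (fun q : ℕ × ℕ => hrCoeffAB (-Δ₁₂ / 2) (Δ₃₄ / 2) Δ ℓ q.1 q.2 / legendreLam ℓ *
        pointFunctional w z zb (crossF s sign (zMono (Δ + (q.1 : ℝ)) q.2)))
      (pointFunctional w z zb (crossF s sign g)) := by
  have hpt : ∀ x y : ℝ, x ∈ Ioo (0 : ℝ) 1 → y ∈ Ioo (0 : ℝ) 1 →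
      HasSum (fun q : ℕ × ℕ => (fun x' y' => hrCoeffAB (-Δ₁₂ / 2) (Δ₃₄ / 2) Δ ℓ q.1 q.2 /
        legendreLam ℓ * zMono (Δ + (q.1 : ℝ)) q.2 x' y') x y) (g x y) :=
    fun x y hx hy => (h.hasSum_hrZTermAB_general_of_lt hΔ h1 hx hy).1
  have hF := evaluationContinuous_pointFunctional w z zb hz hzb (ℕ × ℕ) _ _
    (fun x y hx hy => hasSum_crossF s sign hpt hx hy)
  have hfun : (fun q : ℕ × ℕ => pointFunctional w z zb (crossF s sign
      (fun x' y' => hrCoeffAB (-Δ₁₂ / 2) (Δ₃₄ / 2) Δ ℓ q.1 q.2 / legendreLam ℓ *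
        zMono (Δ + (q.1 : ℝ)) q.2 x' y'))) =
      fun q : ℕ × ℕ => hrCoeffAB (-Δ₁₂ / 2) (Δ₃₄ / 2) Δ ℓ q.1 q.2 / legendreLam ℓ *
        pointFunctional w z zb (crossF s sign (zMono (Δ + (q.1 : ℝ)) q.2)) := by
    funext q
    have hc : crossF s sign (fun x' y' => hrCoeffAB (-Δ₁₂ / 2) (Δ₃₄ / 2) Δ ℓ q.1 q.2 /
        legendreLam ℓ * zMono (Δ + (q.1 : ℝ)) q.2 x' y') =
        fun x' y' => hrCoeffAB (-Δ₁₂ / 2) (Δ₃₄ / 2) Δ ℓ q.1 q.2 / legendreLam ℓ *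
          crossF s sign (zMono (Δ + (q.1 : ℝ)) q.2) x' y' :=
      funext fun x' => funext fun y' => crossF_const_mul s sign _ _ x' y'
    rw [hc]
    have hsm : (fun x' y' => hrCoeffAB (-Δ₁₂ / 2) (Δ₃₄ / 2) Δ ℓ q.1 q.2 / legendreLam ℓ *
        crossF s sign (zMono (Δ + (q.1 : ℝ)) q.2) x' y') =
        (hrCoeffAB (-Δ₁₂ / 2) (Δ₃₄ / 2) Δ ℓ q.1 q.2 / legendreLam ℓ) •
          crossF s sign (zMono (Δ + (q.1 : ℝ)) q.2) := by
      funext x' y'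
      simp only [Pi.smul_apply, smul_eq_mul]
    rw [hsm, map_smul, smul_eq_mul]
  rw [hfun] at hF
  exact hF

/-- **Head–tail rule for a block of arbitrary ordering with a signed tail**: if on the tail (outside the
finite head `S`) every product `A_{n,j}(a,b) · φ[F[𝒫_{Δ+n,j}]]` is `≥ 0` (e.g. `A ≥ 0` by
`hrCoeffAB_nonneg_of_doPochFactor_nonneg` and the term `≥ 0`, or both `≤ 0`), and the head sum is
`≥ 0`, then `φ[F^{s}_{σ}[g]] ≥ 0`. [cite: DolanOsborn2004, §3 eq. (3.11)] [cite: KosPolandSimmonsduffin2014, §3.3 eq. (3.16)] -/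
theorem pointFunctional_crossF_nonneg_of_termwise_general {n : ℕ} (w z zb : Fin n → ℝ)
    (hz : ∀ k, z k ∈ Ioo (0 : ℝ) 1) (hzb : ∀ k, zb k ∈ Ioo (0 : ℝ) 1) (s sign : ℝ)
    {Δ₁₂ Δ₃₄ Δ : ℝ} {ℓ : ℕ} (hΔ : unitarityBound3D ℓ < Δ) (h1 : ℓ = 0 → Δ ≠ 1)
    (S : Finset (ℕ × ℕ))
    (hhead : 0 ≤ ∑ q ∈ S, hrCoeffAB (-Δ₁₂ / 2) (Δ₃₄ / 2) Δ ℓ q.1 q.2 / legendreLam ℓ *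
      pointFunctional w z zb (crossF s sign (zMono (Δ + (q.1 : ℝ)) q.2)))
    (htail : ∀ q : ℕ × ℕ, q ∉ S → 0 ≤ hrCoeffAB (-Δ₁₂ / 2) (Δ₃₄ / 2) Δ ℓ q.1 q.2 *
      pointFunctional w z zb (crossF s sign (zMono (Δ + (q.1 : ℝ)) q.2)))
    {g : ℝ → ℝ → ℝ} (h : IsConformalBlock3D Δ₁₂ Δ₃₄ Δ ℓ g) :
    0 ≤ pointFunctional w z zb (crossF s sign g) := by
  have hS := hasSum_pointFunctional_crossF_hrZAB_general w z zb hz hzb s sign hΔ h1 h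
  refine hhead.trans (sum_le_hasSum S (fun q hq => ?_) hS)
  rw [div_mul_eq_mul_div]
  exact div_nonneg (htail q hq) (legendreLam_pos ℓ).le

end Literature.MathematicalPhysics.QuantumFieldTheory.ConformalBootstrap3D
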